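import Mathlib.Tactic
import HarnessLib
import HarnessLib.Audit.Tags

/-!
# Purely inseparable four-folds — THE LIGHT-TOKEN COUNT of the plane game (cell `res-dim4-pi`, K2(p) lane, B rows, B-LOSSY; the
# ℕ-bookkeeping item K2 of res-dim4-p-11 g6's MAXCONTACT-MEMO §3(iii)/§5, with res-dim4-p-8 g7's sharpening K-P8g7-03; seat res-dim4-p-1 g7)

[OURS · counted 0 · cell `res-dim4-pi` · K2(p) lane (holder res-dim4-p-12 g5, ruling g5-30 «file it»).  Pure integer bookkeeping — no
polynomial, no frame: the «monomial phase» token dynamics of res-dim4-p-11 g6's B-LOSSY CANDIDATE mechanism (MAXCONTACT-MEMO §3(iii), bus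
2026-08-29 14:42:45Z) and res-dim4-p-8 g7's two-line sharpening (K-TWIN K-P8g7-03, bus 14:45:07Z: a lossy move in the monomial phase is
IMMEDIATELY terminal).  Whether the real B-LOSSY tails reach this monomial phase is parts (2)/(3)(i)(ii) of the memo — a candidate text,
NOT proved here or anywhere.]  Nothing here proves any TAIL(p, d, 3), K2(7), K2(p) or resolution of singularities in dimension ≥ 4 /
characteristic `p` — NOT proved.  AI kernel work, weaker than expert review.

THE GAME.  A token `(a, b) ∈ ℕ²` with a threshold `β ≥ 1`; a step charts one of the two plane letters: chart 1 replaces `a` by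
`a + b − β` and either keeps `b` (pure) or kills it (`b := 0`, translated); chart 2 symmetrically; a step is LEGAL only if `β ≤ a + b`.
A token is LIGHT if `a < β` and `b < β`.
* `light_step` — a legal step from a light token gives a light token with STRICTLY SMALLER total `a + b`;
* **`no_infinite_light_play`** — hence no infinite legal play starts from a light token (the total would descend for ever);
* **`lossy_move_terminal`** (p-8's sharpening) — after a LOSSY move every token of the state has the killed coordinate `0`, so the next state
  cannot be both LEGAL (every token `β_λ ≤ n_λ + 0`) and LIGHT in the killed letter for some token (`n_λ < β_λ`): the first lossy move of
  the monomial phase ends the play at once, whatever the exponents.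
bears_on: LADDER-RESOLUTION:D157-DOOR2 (res-dim4-pi · B-LOSSY plane game · light-token count).  Supports stmt-ResolutionOfSingularities-16155 (helper).
-/

set_option linter.dupNamespace false -- mandated namespace of this single-conjunct summit

namespace Summit.ResolutionOfSingularities.ResolutionOfSingularities.Theorems.PIDim4
namespace ResCone
namespace TokenGame

/-- **ONE LEGAL STEP FROM A LIGHT TOKEN**: light stays light and the total drops. [OURS] -/
theorem light_step {β a b a' b' : ℕ} (hβ : 1 ≤ β) (hleg : β ≤ a + b) (ha : a < β) (hb : b < β)
    (hstep : (a' = a + b - β ∧ (b' = b ∨ b' = 0)) ∨ (b' = a + b - β ∧ (a' = a ∨ a' = 0))) :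
    a' < β ∧ b' < β ∧ a' + b' < a + b := by
  rcases hstep with ⟨ha', hb' | hb'⟩ | ⟨hb', ha' | ha'⟩ <;> subst ha' <;> subst hb' <;> omega

/-- **NO INFINITE LEGAL PLAY FROM A LIGHT TOKEN** (the light-token count): along any play `t ↦ (a t, b t)` of legal steps, a light token at
time `t₀` is impossible — its total would strictly decrease for ever. [OURS] -/
theorem no_infinite_light_play {β : ℕ} (hβ : 1 ≤ β) (a b : ℕ → ℕ)
    (hstep : ∀ t, (a (t + 1) = a t + b t - β ∧ (b (t + 1) = b t ∨ b (t + 1) = 0)) ∨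
      (b (t + 1) = a t + b t - β ∧ (a (t + 1) = a t ∨ a (t + 1) = 0)))
    (hleg : ∀ t, β ≤ a t + b t) {t₀ : ℕ} (ha : a t₀ < β) (hb : b t₀ < β) : False := by
  -- light for ever, total dropping by at least one per step
  have key : ∀ n, a (t₀ + n) < β ∧ b (t₀ + n) < β ∧ a (t₀ + n) + b (t₀ + n) + n ≤ a t₀ + b t₀ := by
    intro n
    induction n with
    | zero => rw [Nat.add_zero]; exact ⟨ha, hb, by omega⟩
    | succ n ih =>
      obtain ⟨h1, h2, h3⟩ := light_step hβ (hleg (t₀ + n)) ih.1 ih.2.1 (hstep (t₀ + n))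
      rw [show t₀ + (n + 1) = t₀ + n + 1 by ring]
      exact ⟨h1, h2, by omega⟩
  have h := key (a t₀ + b t₀ + 1)
  omega

/-- **A LOSSY MOVE IN THE MONOMIAL PHASE IS IMMEDIATELY TERMINAL** (res-dim4-p-8 g7, K-P8g7-03): if after the move every token `λ`
reads `(n λ, 0)` (the killed letter's exponent is `0`), then «legal for every token» (`β λ ≤ n λ + 0`) and «some token light in the surviving
letter» (`n λ₀ < β λ₀`) contradict each other. Stated for an arbitrary index type of tokens. [OURS] -/
theorem lossy_move_terminal {Λ : Type*} (β n : Λ → ℕ) (hlegal : ∀ l, β l ≤ n l + 0) {l₀ : Λ} (hlight : n l₀ < β l₀) : False := by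
  have h := hlegal l₀
  omega

end TokenGame
end ResCone
end Summit.ResolutionOfSingularities.ResolutionOfSingularities.Theorems.PIDim4
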